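import Literature.AnabelianGeometry.SemiGraphs.PSCSmoothProperShape
import Mathlib.Data.ZMod.Basic
import Mathlib.Algebra.Group.TypeTags.Finite
import HarnessLib

/-!
# The [CombGC] §1 / [IUTchI] Rmk. 1.2.3 origin schemata: their universal closures are false (abc-iut plan R1 (ii))

Mochizuki, *A combinatorial version of the Grothendieck conjecture* [CombGC] §1 pp. 8–14 and
[IUTchI] Rmk. 1.2.3 pp. 41–43, typed in `PSCGraphicity.lean` / `PSCRamification.lean` (abc-iut-L3-t4)
as SCHEMATA `…Holds Ω` over the origin parameter `Ω : PSCOrigin` (Def. 1.1 (i) "of pro-Σ PSC-type",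
never constructed).  The abc-iut FACT-LIST carries them as rows F-0444 (Thm. 1.6 (ii)), F-0458
(Thm. 1.6 (i)), F-0459 (Prop. 1.2 (i)), F-0461 (Thm. 1.6 (iii)), F-0466 (Rmk. 1.4.3), F-1931
([IUTchI] Rmk. 1.2.3 (iv), cuspidal), F-1937 (Rmk. 1.2.3 (v)).  Per the cell's rule for parametrised
rows (plan R1 (ii)) this PROOF-ONLY file records that the UNIVERSAL CLOSURE `∀ Ω, …Holds Ω` of each is
FALSE — at the all-inclusive origin (`IsOfPSCType := True`) the printed conclusions fail for explicit
junk data over the discrete group of order 2 (`not_forall_<row>`), exactly as the typing file's docstring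
warns ("FALSE for arbitrary data satisfying the axioms of `PSCDatum`") — so that the rows are consumed
only as ORIGIN-RELATIVE assumptions.  The complementary positive information (all these rows HOLD at
every origin of smooth-proper-shaped data, inhabited by a genuine curve datum) is
`PSCSmoothProperOrigin.lean`; row F-1938 is treated in `PSCUnrVerticialOneVertex.lean`; rows
F-0438/0440/0442/0443 are abc-iut-f-009's.  Refuting a universal closure asserts nothing about curves;
no side is taken on [IUTchIII] Cor. 3.12. [cite: MochizukiCombGC2007, §1 pp.8-14]
-/

noncomputable section

namespace Literature.AnabelianGeometry.SemiGraphs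

namespace PSCDatum

open scoped Pointwise

/-- The all-inclusive origin: every datum is declared "of PSC-type". [folklore] -/
private theorem all_isOfPSCType {Q : Type} [Group Q] [TopologicalSpace Q] (G : PSCDatum Q) :
    (⟨fun _ => True⟩ : PSCOrigin.{0}).IsOfPSCType G := trivial

/-- The order-2 group has two elements. [folklore] -/
private theorem natCard_two : Nat.card (Multiplicative (ZMod 2)) = 2 := by
  rw [Nat.card_eq_fintype_card, Fintype.card_multiplicative, ZMod.card]

/-- The order-2 group is pro-`{2}`. [folklore] -/
private theorem isProSigma_two [TopologicalSpace (Multiplicative (ZMod 2))] :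
    IsProSigma {2} (Multiplicative (ZMod 2)) :=
  ⟨fun U _ p hp hdvd => by
    have h2 : Nat.card (Multiplicative (ZMod 2) ⧸ U.toSubgroup) ∣ 2 := by
      have := Subgroup.card_quotient_dvd_card U.toSubgroup
      rwa [natCard_two] at this
    exact (Nat.prime_dvd_prime_iff_eq hp Nat.prime_two).mp (hdvd.trans h2)⟩

/-- `⊤ ≠ ⊥` in the subgroup lattice of the order-2 group. [folklore] -/
private theorem top_ne_bot_two : (⊤ : Subgroup (Multiplicative (ZMod 2))) ≠ ⊥ := by
  intro h
  have : (Multiplicative.ofAdd (1 : ZMod 2)) ∈ (⊥ : Subgroup (Multiplicative (ZMod 2))) :=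
    h ▸ Subgroup.mem_top _
  exact absurd (Subgroup.mem_bot.mp this) (by decide)

/-! ### F-0459 — Prop. 1.2 (i) -/

/-- **The universal closure of F-0459 (Prop. 1.2 (i)) is false**: two vertices carrying the SAME
verticial subgroup `Π` (junk datum, no edges) have open intersection but are distinct.
[cite: MochizukiCombGC2007, Prop 1.2(i) p.8] -/
theorem not_forall_openInterDeterminesComponentHolds :
    ¬ ∀ Ω : PSCOrigin.{0}, OpenInterDeterminesComponentHolds Ω := by
  intro h
  letI : TopologicalSpace (Multiplicative (ZMod 2)) := ⊥
  haveI : DiscreteTopology (Multiplicative (ZMod 2)) := ⟨rfl⟩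
  let G : PSCDatum (Multiplicative (ZMod 2)) :=
    { Sigma := {p | p.Prime}, sigma_prime := fun _ hp => hp, sigma_nonempty := ⟨2, Nat.prime_two⟩
      graph := { V := Bool, N := Empty, C := Empty, nodeEnds := Empty.elim, cuspEnd := Empty.elim }
      vertGp := fun _ => ⊤, nodeGp := Empty.elim, cuspGp := Empty.elim, genus := fun _ => 2
      isClosed_vertGp := fun _ => isClosed_discrete _
      isClosed_nodeGp := fun e => e.elim, isClosed_cuspGp := fun c => c.elim
      nodeGp_le := fun e => e.elim, cuspGp_le := fun c => c.elim
      proSigma := ⟨fun _ _ _ hp _ => hp⟩ }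
  have hv := (h _ G (all_isOfPSCType G)).1 true false 1 1 (isOpen_discrete _)
  exact Bool.noConfusion hv

/-! ### F-0458 — Thm. 1.6 (i) -/

/-- **The universal closure of F-0458 (Thm. 1.6 (i)) is false**: one vertex with TWO cusps vs ONE
cusp, all groups `Π`, `α = id`: group-theoretically cuspidal (the cuspidal subgroups are `Π` on both
sides) but not numerically cuspidal (`r = 2 ≠ 1` at the trivial covering).
[cite: MochizukiCombGC2007, Thm 1.6(i) p.13] -/
theorem not_forall_numericallyCuspidalIffHolds :
    ¬ ∀ Ω : PSCOrigin.{0}, NumericallyCuspidalIffHolds Ω := by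
  intro h
  letI : TopologicalSpace (Multiplicative (ZMod 2)) := ⊥
  haveI : DiscreteTopology (Multiplicative (ZMod 2)) := ⟨rfl⟩
  let G : PSCDatum (Multiplicative (ZMod 2)) :=
    { Sigma := {p | p.Prime}, sigma_prime := fun _ hp => hp, sigma_nonempty := ⟨2, Nat.prime_two⟩
      graph := { V := Unit, N := Empty, C := Bool, nodeEnds := Empty.elim, cuspEnd := fun _ => () }
      vertGp := fun _ => ⊤, nodeGp := Empty.elim, cuspGp := fun _ => ⊤, genus := fun _ => 2
      isClosed_vertGp := fun _ => isClosed_discrete _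
      isClosed_nodeGp := fun e => e.elim, isClosed_cuspGp := fun _ => isClosed_discrete _
      nodeGp_le := fun e => e.elim, cuspGp_le := fun _ => ⟨1, le_top⟩
      proSigma := ⟨fun _ _ _ hp _ => hp⟩ }
  let H : PSCDatum (Multiplicative (ZMod 2)) :=
    { Sigma := {p | p.Prime}, sigma_prime := fun _ hp => hp, sigma_nonempty := ⟨2, Nat.prime_two⟩
      graph := { V := Unit, N := Empty, C := Unit, nodeEnds := Empty.elim, cuspEnd := fun _ => () }
      vertGp := fun _ => ⊤, nodeGp := Empty.elim, cuspGp := fun _ => ⊤, genus := fun _ => 2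
      isClosed_vertGp := fun _ => isClosed_discrete _
      isClosed_nodeGp := fun e => e.elim, isClosed_cuspGp := fun _ => isClosed_discrete _
      nodeGp_le := fun e => e.elim, cuspGp_le := fun _ => ⟨1, le_top⟩
      proSigma := ⟨fun _ _ _ hp _ => hp⟩ }
  have hG : ∀ A, G.IsCuspidal A ↔ A = ⊤ := fun A =>
    ⟨by rintro ⟨c, γ, rfl⟩; exact conjAct_smul_top γ, fun hA => ⟨true, 1, by rw [hA, one_smul]⟩⟩
  have hH : ∀ B, H.IsCuspidal B ↔ B = ⊤ := fun B =>
    ⟨by rintro ⟨c, γ, rfl⟩; exact conjAct_smul_top γ, fun hB => ⟨(), 1, by rw [hB, one_smul]⟩⟩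
  have hiff := h _ G H (ContinuousMulEquiv.refl _) (all_isOfPSCType G) (all_isOfPSCType H)
  have hgt : G.IsGroupTheoreticallyCuspidal H (ContinuousMulEquiv.refl _) := by
    refine ⟨fun A hA => (hH _).mpr ?_, fun B hB => ⟨⊤, (hG ⊤).mpr rfl, ?_⟩⟩
    · rw [(hG A).mp hA]; exact Subgroup.map_top_of_surjective _ (ContinuousMulEquiv.refl _).surjective
    · rw [(hH B).mp hB]; exact Subgroup.map_top_of_surjective _ (ContinuousMulEquiv.refl _).surjective
  have hnum := (hiff.mpr hgt) ⊤ (by rw [Subgroup.coe_top]; exact isOpen_univ)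
  rw [Subgroup.map_top_of_surjective _ (ContinuousMulEquiv.refl _).surjective, cuspCount_top,
    cuspCount_top] at hnum
  change Fintype.card Bool = Fintype.card Unit at hnum
  simp at hnum

/-! ### F-0444 — Thm. 1.6 (ii) -/

/-- No edges ⇒ `edgeFil U = closure [U, U]` (private copy of the lemma of
`PSCNodeExistenceTransferProofs.lean`). [cite: MochizukiCombGC2007, Def 1.1(ii) p.7] -/
private theorem edgeFil_eq_closure_commutator'' {P : Type} [Group P] [TopologicalSpace P]
    [IsTopologicalGroup P] (G : PSCDatum P) [IsEmpty G.graph.N] [IsEmpty G.graph.C]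
    (U : Subgroup P) : G.edgeFil U = (⁅U, U⁆ : Subgroup P).topologicalClosure := by
  haveI : IsEmpty {A : Subgroup P // G.IsEdgeLikeIn U A} :=
    ⟨fun A => by obtain ⟨B, hB, -⟩ := A.2; exact G.not_isEdgeLike_of_isEmpty B hB⟩
  unfold edgeFil
  rw [iSup_of_empty, sup_bot_eq]

/-- **The universal closure of F-0444 (Thm. 1.6 (ii)) is false**: a one-vertex and a two-vertex
edgeless datum with all verticial subgroups `Π`, `α = id`: graphically filtration-preserving
(`M^vert = M`, `M^edge = 0` on both sides) but not graphic (the semi-graphs are not isomorphic).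
[cite: MochizukiCombGC2007, Thm 1.6(ii) p.13] -/
theorem not_forall_graphicIffFiltrationPreservingHolds :
    ¬ ∀ Ω : PSCOrigin.{0}, GraphicIffFiltrationPreservingHolds Ω := by
  intro h
  letI : TopologicalSpace (Multiplicative (ZMod 2)) := ⊥
  haveI : DiscreteTopology (Multiplicative (ZMod 2)) := ⟨rfl⟩
  let G : PSCDatum (Multiplicative (ZMod 2)) :=
    { Sigma := {p | p.Prime}, sigma_prime := fun _ hp => hp, sigma_nonempty := ⟨2, Nat.prime_two⟩
      graph := { V := Unit, N := Empty, C := Empty, nodeEnds := Empty.elim, cuspEnd := Empty.elim }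
      vertGp := fun _ => ⊤, nodeGp := Empty.elim, cuspGp := Empty.elim, genus := fun _ => 2
      isClosed_vertGp := fun _ => isClosed_discrete _
      isClosed_nodeGp := fun e => e.elim, isClosed_cuspGp := fun c => c.elim
      nodeGp_le := fun e => e.elim, cuspGp_le := fun c => c.elim
      proSigma := ⟨fun _ _ _ hp _ => hp⟩ }
  let H : PSCDatum (Multiplicative (ZMod 2)) :=
    { Sigma := {p | p.Prime}, sigma_prime := fun _ hp => hp, sigma_nonempty := ⟨2, Nat.prime_two⟩
      graph := { V := Bool, N := Empty, C := Empty, nodeEnds := Empty.elim, cuspEnd := Empty.elim }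
      vertGp := fun _ => ⊤, nodeGp := Empty.elim, cuspGp := Empty.elim, genus := fun _ => 2
      isClosed_vertGp := fun _ => isClosed_discrete _
      isClosed_nodeGp := fun e => e.elim, isClosed_cuspGp := fun c => c.elim
      nodeGp_le := fun e => e.elim, cuspGp_le := fun c => c.elim
      proSigma := ⟨fun _ _ _ hp _ => hp⟩ }
  haveI : IsEmpty G.graph.N := inferInstanceAs (IsEmpty Empty)
  haveI : IsEmpty G.graph.C := inferInstanceAs (IsEmpty Empty)
  haveI : IsEmpty H.graph.N := inferInstanceAs (IsEmpty Empty)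
  haveI : IsEmpty H.graph.C := inferInstanceAs (IsEmpty Empty)
  have hiff := h _ G H (ContinuousMulEquiv.refl _) (all_isOfPSCType G) (all_isOfPSCType H)
  have hfp : G.IsGraphicallyFiltrationPreserving H (ContinuousMulEquiv.refl _) := by
    refine ⟨fun U _ => ?_, fun U _ => ?_⟩
    · rw [G.vertFil_eq_of_vertGp_eq_top (fun _ => rfl) (), H.vertFil_eq_of_vertGp_eq_top (fun _ => rfl) true]
      change (U.topologicalClosure).map (MonoidHom.id _) = (U.map (MonoidHom.id _)).topologicalClosure
      rw [Subgroup.map_id, Subgroup.map_id]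
    · rw [edgeFil_eq_closure_commutator'' G, edgeFil_eq_closure_commutator'' H]
      change ((⁅U, U⁆ : Subgroup _).topologicalClosure).map (MonoidHom.id _) =
        (⁅U.map (MonoidHom.id _), U.map (MonoidHom.id _)⁆ : Subgroup _).topologicalClosure
      rw [Subgroup.map_id, Subgroup.map_id]
  obtain ⟨ι, -⟩ := hiff.mpr hfp
  have : ι.vertEquiv.symm true = ι.vertEquiv.symm false := Subsingleton.elim _ _
  exact Bool.noConfusion (ι.vertEquiv.symm.injective this)

/-! ### F-0461 — Thm. 1.6 (iii) -/

/-- **The universal closure of F-0461 (Thm. 1.6 (iii)) is false**: `G` = one vertex with `Π_v = Π`,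
`H` = two vertices with `Π_v = Π`, `Π_w = 1` (both sturdy, no edges, `β = id`): verticially
filtration-preserving, but not group-theoretically verticial (`1 · Ker = 1` is unramified verticial for
`H`, not for `G`). [cite: MochizukiCombGC2007, Thm 1.6(iii) p.13] -/
theorem not_forall_unrVerticialIffHolds :
    ¬ ∀ Ω : PSCOrigin.{0}, UnrVerticialIffHolds Ω := by
  intro h
  letI : TopologicalSpace (Multiplicative (ZMod 2)) := ⊥
  haveI : DiscreteTopology (Multiplicative (ZMod 2)) := ⟨rfl⟩
  let G : PSCDatum (Multiplicative (ZMod 2)) :=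
    { Sigma := {p | p.Prime}, sigma_prime := fun _ hp => hp, sigma_nonempty := ⟨2, Nat.prime_two⟩
      graph := { V := Unit, N := Empty, C := Empty, nodeEnds := Empty.elim, cuspEnd := Empty.elim }
      vertGp := fun _ => ⊤, nodeGp := Empty.elim, cuspGp := Empty.elim, genus := fun _ => 2
      isClosed_vertGp := fun _ => isClosed_discrete _
      isClosed_nodeGp := fun e => e.elim, isClosed_cuspGp := fun c => c.elim
      nodeGp_le := fun e => e.elim, cuspGp_le := fun c => c.elim
      proSigma := ⟨fun _ _ _ hp _ => hp⟩ }
  let H : PSCDatum (Multiplicative (ZMod 2)) :=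
    { Sigma := {p | p.Prime}, sigma_prime := fun _ hp => hp, sigma_nonempty := ⟨2, Nat.prime_two⟩
      graph := { V := Bool, N := Empty, C := Empty, nodeEnds := Empty.elim, cuspEnd := Empty.elim }
      vertGp := fun b => if b then ⊤ else ⊥, nodeGp := Empty.elim, cuspGp := Empty.elim
      genus := fun _ => 2
      isClosed_vertGp := fun _ => isClosed_discrete _
      isClosed_nodeGp := fun e => e.elim, isClosed_cuspGp := fun c => c.elim
      nodeGp_le := fun e => e.elim, cuspGp_le := fun c => c.elim
      proSigma := ⟨fun _ _ _ hp _ => hp⟩ }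
  haveI : IsEmpty G.graph.N := inferInstanceAs (IsEmpty Empty)
  haveI : IsEmpty G.graph.C := inferInstanceAs (IsEmpty Empty)
  haveI : IsEmpty H.graph.N := inferInstanceAs (IsEmpty Empty)
  haveI : IsEmpty H.graph.C := inferInstanceAs (IsEmpty Empty)
  have hKG : G.unrKer = ⊥ := by
    rw [G.unrKer_eq_closure_bot_of_isEmpty]
    exact le_antisymm (Subgroup.topologicalClosure_minimal _ le_rfl (isClosed_discrete _)) bot_le
  have hKH : H.unrKer = ⊥ := by
    rw [H.unrKer_eq_closure_bot_of_isEmpty]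
    exact le_antisymm (Subgroup.topologicalClosure_minimal _ le_rfl (isClosed_discrete _)) bot_le
  -- `β = id` (the two kernels are the same subgroup, definitionally)
  let β : (Multiplicative (ZMod 2) ⧸ G.unrKer) ≃ₜ* (Multiplicative (ZMod 2) ⧸ H.unrKer) :=
    ContinuousMulEquiv.refl _
  -- the transport along `β = id` enlarges: `S ≤ β_*(S)`
  have hle : ∀ S : Subgroup (Multiplicative (ZMod 2)), S ≤ G.unrTransport H β S := fun S x hx =>
    ⟨QuotientGroup.mk' G.unrKer x, ⟨x, hx, rfl⟩, rfl⟩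
  have hiff := h _ G H β (all_isOfPSCType G) (all_isOfPSCType H) (fun _ => le_rfl) (fun _ => le_rfl)
  -- `H.vertFil W = W` for open `W`
  have hHv : ∀ W : Subgroup (Multiplicative (ZMod 2)), H.vertFil W = W := by
    intro W
    have hsup : (⨆ A : {A : Subgroup _ // H.IsVerticialIn W A}, (A : Subgroup _)) = W := by
      refine le_antisymm (iSup_le fun A => ?_) ?_
      · obtain ⟨B, -, hA⟩ := A.2
        rw [hA]; exact inf_le_left
      · have hW : H.IsVerticialIn W W := ⟨⊤, ⟨true, 1, (one_smul _ _).symm⟩, by rw [inf_top_eq]⟩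
        exact le_iSup (fun A : {A : Subgroup (Multiplicative (ZMod 2)) // H.IsVerticialIn W A} =>
          (A.1 : Subgroup (Multiplicative (ZMod 2)))) ⟨W, hW⟩
    unfold vertFil
    rw [hsup, sup_eq_right.mpr (Subgroup.commutator_le.mpr fun _ ha _ hb =>
      W.mul_mem (W.mul_mem (W.mul_mem ha hb) (W.inv_mem ha)) (W.inv_mem hb))]
    exact le_antisymm (Subgroup.topologicalClosure_minimal _ le_rfl (isClosed_discrete _))
      (Subgroup.le_topologicalClosure W)
  have hfp : G.IsUnrVerticiallyFiltrationPreserving H β := fun U hU _ => by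
    rw [G.vertFil_eq_self_of_isOpen (fun _ => rfl) () hU, hHv]
  obtain ⟨-, hsurj⟩ := hiff.mp hfp
  obtain ⟨B, hB, hBB'⟩ := hsurj (H.vertGp false ⊔ H.unrKer) ⟨H.vertGp false, ⟨false, 1, (one_smul _ _).symm⟩, rfl⟩
  have hBtop : B = ⊤ := (G.isUnrVerticial_iff_eq_top_of_vertGp_eq_top (fun _ => rfl) () B).mp hB
  have htop : (⊤ : Subgroup (Multiplicative (ZMod 2))) ≤ H.vertGp false ⊔ H.unrKer := by
    rw [← hBB', ← hBtop]; exact hle B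
  rw [hKH, sup_bot_eq, top_le_iff] at htop
  exact top_ne_bot_two htop.symm

/-! ### F-0466 — Rmk. 1.4.3 -/

/-- **The universal closure of F-0466 (Rmk. 1.4.3) is false**: two vertices both with `Π_v = Π`
(sturdy, no edges, `Σ = {2}`, `Π` of order 2), the `Π^unr`-covering `1 ≤ Π` of degree 2: any auxiliary
covering `G''` trivial over `G_v` is `G` itself, and `1 ≤ Π` is not verticially PURELY totally ramified
(the other vertex also carries `Π`). [cite: MochizukiCombGC2007, Rmk 1.4.3 p.12] -/
theorem not_forall_auxiliaryCoveringsExistHolds :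
    ¬ ∀ Ω : PSCOrigin.{0}, AuxiliaryCoveringsExistHolds Ω := by
  intro h
  letI : TopologicalSpace (Multiplicative (ZMod 2)) := ⊥
  haveI : DiscreteTopology (Multiplicative (ZMod 2)) := ⟨rfl⟩
  let G : PSCDatum (Multiplicative (ZMod 2)) :=
    { Sigma := {2}, sigma_prime := by simp [Nat.prime_two], sigma_nonempty := ⟨2, rfl⟩
      graph := { V := Bool, N := Empty, C := Empty, nodeEnds := Empty.elim, cuspEnd := Empty.elim }
      vertGp := fun _ => ⊤, nodeGp := Empty.elim, cuspGp := Empty.elim, genus := fun _ => 2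
      isClosed_vertGp := fun _ => isClosed_discrete _
      isClosed_nodeGp := fun e => e.elim, isClosed_cuspGp := fun c => c.elim
      nodeGp_le := fun e => e.elim, cuspGp_le := fun c => c.elim
      proSigma := isProSigma_two }
  haveI : IsEmpty G.graph.N := inferInstanceAs (IsEmpty Empty)
  haveI : IsEmpty G.graph.C := inferInstanceAs (IsEmpty Empty)
  have hK : G.unrKer = ⊥ := by
    rw [G.unrKer_eq_closure_bot_of_isEmpty]
    exact le_antisymm (Subgroup.topologicalClosure_minimal _ le_rfl (isClosed_discrete _)) bot_le
  have hidx : (⊥ : Subgroup (Multiplicative (ZMod 2))).index = 2 ^ 1 := by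
    rw [Subgroup.index_bot, natCard_two, pow_one]
  obtain ⟨H'', -, -, hnc, -, v₁, γ₁, -, hall⟩ :=
    (h _ G (all_isOfPSCType G)).2.2 (fun _ => le_rfl) 2 1 ⊥ true 1 rfl inferInstance
      (isOpen_discrete _) hidx (by change G.unrKer ≤ ⊥; rw [hK])
      (by change (1 : ConjAct (Multiplicative (ZMod 2))) • (⊤ : Subgroup (Multiplicative (ZMod 2))) ⊔ ⊥ = ⊤
          rw [one_smul, sup_bot_eq])
  have hH'' : H'' = ⊤ := top_le_iff.mp fun x _ =>
    hnc (Subgroup.subset_normalClosure (by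
      change x ∈ (((1 : ConjAct (Multiplicative (ZMod 2))) •
        (⊤ : Subgroup (Multiplicative (ZMod 2))) : Subgroup (Multiplicative (ZMod 2))) :
          Set (Multiplicative (ZMod 2)))
      rw [one_smul]; exact Subgroup.mem_top x))
  have hbad := hall (!v₁) 1 (Or.inl (by cases v₁ <;> simp))
  rw [hH'', top_inf_eq, top_inf_eq] at hbad
  change (1 : ConjAct (Multiplicative (ZMod 2))) • (⊤ : Subgroup (Multiplicative (ZMod 2))) ≤ ⊥ at hbad
  rw [one_smul, top_le_iff] at hbad
  exact top_ne_bot_two hbad.symm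

/-! ### F-1931 — [IUTchI] Rmk. 1.2.3 (iv), cuspidal half -/

/-- **The universal closure of F-1931 ([IUTchI] Rmk. 1.2.3 (iv), cuspidal) is false**: over a FINITE
`Π` (one vertex, one cusp, all groups `Π`, `Σ = {2}`) the subgroup `Π` is cuspidal but not infinite,
so it fails the printed characterization ("isomorphic to `ℤ_l`").
[cite: Mochizuki2012, IUTchI Rmk 1.2.3(iv) pp.41-42] -/
theorem not_forall_cuspidalEdgeLikeCharacterizationHolds :
    ¬ ∀ Ω : PSCOrigin.{0}, CuspidalEdgeLikeCharacterizationHolds Ω := by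
  intro h
  letI : TopologicalSpace (Multiplicative (ZMod 2)) := ⊥
  haveI : DiscreteTopology (Multiplicative (ZMod 2)) := ⟨rfl⟩
  let G : PSCDatum (Multiplicative (ZMod 2)) :=
    { Sigma := {2}, sigma_prime := by simp [Nat.prime_two], sigma_nonempty := ⟨2, rfl⟩
      graph := { V := Unit, N := Empty, C := Unit, nodeEnds := Empty.elim, cuspEnd := fun _ => () }
      vertGp := fun _ => ⊤, nodeGp := Empty.elim, cuspGp := fun _ => ⊤, genus := fun _ => 2
      isClosed_vertGp := fun _ => isClosed_discrete _
      isClosed_nodeGp := fun e => e.elim, isClosed_cuspGp := fun _ => isClosed_discrete _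
      nodeGp_le := fun e => e.elim, cuspGp_le := fun _ => ⟨1, le_top⟩
      proSigma := isProSigma_two }
  have hc : G.IsCuspidal ⊤ := ⟨(), 1, (one_smul _ _).symm⟩
  have h1 := h _ G (all_isOfPSCType G) 2 rfl
  dsimp only at h1
  obtain ⟨⟨-, -, hinf, -⟩, -⟩ := (h1 ⊤).mp hc
  exact hinf (Set.toFinite _)

/-! ### F-1937 — [IUTchI] Rmk. 1.2.3 (v) -/

/-- **The universal closure of F-1937 ([IUTchI] Rmk. 1.2.3 (v)) is false**: over a FINITE `Π` (one
vertex with a loop, no cusps, all groups `Π`, `Σ = {2}`) the subgroup `Π` is nodal but not infinite.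
[cite: Mochizuki2012, IUTchI Rmk 1.2.3(v) p.43] -/
theorem not_forall_nodalEdgeLikeCharacterizationHolds :
    ¬ ∀ Ω : PSCOrigin.{0}, NodalEdgeLikeCharacterizationHolds Ω := by
  intro h
  letI : TopologicalSpace (Multiplicative (ZMod 2)) := ⊥
  haveI : DiscreteTopology (Multiplicative (ZMod 2)) := ⟨rfl⟩
  let G : PSCDatum (Multiplicative (ZMod 2)) :=
    { Sigma := {2}, sigma_prime := by simp [Nat.prime_two], sigma_nonempty := ⟨2, rfl⟩
      graph := { V := Unit, N := Unit, C := Empty, nodeEnds := fun _ => s((), ()),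
                 cuspEnd := Empty.elim }
      vertGp := fun _ => ⊤, nodeGp := fun _ => ⊤, cuspGp := Empty.elim, genus := fun _ => 2
      isClosed_vertGp := fun _ => isClosed_discrete _
      isClosed_nodeGp := fun _ => isClosed_discrete _, isClosed_cuspGp := fun c => c.elim
      nodeGp_le := fun _ => ⟨(), (), rfl, ⟨1, le_top⟩, ⟨1, le_top⟩⟩, cuspGp_le := fun c => c.elim
      proSigma := isProSigma_two }
  have hn : G.IsNodal ⊤ := ⟨(), 1, (one_smul _ _).symm⟩
  have hnc : G.graph.IsNoncuspidal := by
    change Fintype.card Empty = 0; rfl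
  have h1 := h _ G (all_isOfPSCType G) hnc 2 rfl
  dsimp only at h1
  obtain ⟨⟨-, -, hinf, -⟩, -⟩ := (h1.1 ⊤).mp hn
  exact hinf (Set.toFinite _)

end PSCDatum

end Literature.AnabelianGeometry.SemiGraphs

end
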